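import Summits.CriticalPhenomena.PercolationContinuityZ3.Theorems.PercNearOneGluingNoHeavyLowerTailMajorityGluingZFourteenEightHG1C1
import Summits.CriticalPhenomena.PercolationContinuityZ3.Theorems.PercNearOneGluingNoHeavyLowerTailMajorityGluingZFourteenEightHG2C1
import Summits.CriticalPhenomena.PercolationContinuityZ3.Theorems.PercNearOneGluingNoHeavyLowerTailMajorityGluingZFourteenEightHG3C1
import Summits.CriticalPhenomena.PercolationContinuityZ3.Theorems.PercNearOneGluingNoHeavyLowerTailMajorityGluingZFourteenEightHG4C1
import Summits.CriticalPhenomena.PercolationContinuityZ3.Theorems.PercNearOneGluingNoHeavyLowerTailMajorityGluingZFourteenEightHG5C1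
import Summits.CriticalPhenomena.PercolationContinuityZ3.Theorems.PercNearOneGluingNoHeavyLowerTailMajorityGluingZFourteenEightHG6C1
import Summits.CriticalPhenomena.PercolationContinuityZ3.Theorems.PercNearOneGluingNoHeavyLowerTailMajorityGluingZFourteenEightHG7C1
import Summits.CriticalPhenomena.PercolationContinuityZ3.Theorems.PercNearOneGluingNoHeavyLowerTailMajorityGluingZRangeAM
import HarnessLib

/-!
# Key range 1 of 6 of the `(14,8)` certificate at `c = 3/2`: the merged group chunks pass the run check (lane prim-rate, constants-miner 1, gen 39; cert/mkhier.py)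

Support file for the closed crux `NoHeavyLowerTail` (stmt-CriticalPhenomena-4575), majority-gluing line.  The range-1 chunks of the 7 group digests are combined by a binary tree
of aggregated merges and run-checked by the kernel; hence their total value is nonnegative at every nonnegative key valuation (`fourteenEightT2R1_nonneg`).  No sorries.
[cite: VandenbergKahn2001, Thm 1.2 (p. 123)]
-/

namespace Summit.CriticalPhenomena.PercolationContinuityZ3.Theorems

namespace HubOnly
namespace QCert

/-- The aggregate-merge tree of the range-1 chunks. -/
def fourteenEightT2R1T : List (ℕ × ℤ) :=
  am (am (am (fourteenEightT2G1C1) (fourteenEightT2G2C1)) (am (fourteenEightT2G3C1) (fourteenEightT2G4C1))) (am (am (fourteenEightT2G5C1) (fourteenEightT2G6C1)) (fourteenEightT2G7C1))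

set_option maxRecDepth 8192 in
set_option maxHeartbeats 0 in
/-- **The range-1 tree passes the run check** (kernel evaluation). -/
theorem fourteenEightT2R1_runs : runsOK fourteenEightT2R1T = true := by
  decide +kernel

/-- The tree's value is the value of the chunks. -/
theorem fourteenEightT2R1_treeVal (val : ℕ → ℝ) : evalC val fourteenEightT2R1T = evalC val [fourteenEightT2G1C1, fourteenEightT2G2C1, fourteenEightT2G3C1, fourteenEightT2G4C1, fourteenEightT2G5C1, fourteenEightT2G6C1, fourteenEightT2G7C1].flatten := by
  simp only [fourteenEightT2R1T, evalC_am, List.flatten_cons, List.flatten_nil, evalC_append, evalC_nil', add_assoc, add_zero]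

/-- **The range-1 chunks of all groups have nonnegative total value** at every nonnegative key valuation. -/
theorem fourteenEightT2R1_nonneg (val : ℕ → ℝ) (hval : ∀ key, 0 ≤ val key) : 0 ≤ evalC val [fourteenEightT2G1C1, fourteenEightT2G2C1, fourteenEightT2G3C1, fourteenEightT2G4C1, fourteenEightT2G5C1, fourteenEightT2G6C1, fourteenEightT2G7C1].flatten := by
  rw [← fourteenEightT2R1_treeVal val]
  exact evalC_nonneg_of_runsOK val hval _ fourteenEightT2R1_runs

end QCert
end HubOnly

end Summit.CriticalPhenomena.PercolationContinuityZ3.Theorems
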